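import Summits.AtomisticToContinuum.Crystallization.Theorems.ReggeStarCoercivityDefectFreeCrystallizesGoodLaw
import Summits.AtomisticToContinuum.Crystallization.Theorems.ReggeStarCoercivityDefectFreeCrystallizesChargeFromLaw
import Summits.AtomisticToContinuum.Crystallization.Theorems.ReggeStarCoercivityDefectFreeCrystallizesFunnelReduction
import Summits.AtomisticToContinuum.Crystallization.Theorems.PalmUnimodularRigidityChargedPatternCrystallizes
import Literature.MathematicalPhysics.StatisticalMechanics.LennardJonesClusters

/-!
# Crux `ReggeStarCoercivity.DefectFreeCrystallizes` (stmt-AtomisticToContinuum-13603) modulo the Palm route's residuals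

Documentation theorem (lead c1, line `palm-good-law`): the crux follows from the one open stub S7″
`stub_thresholdBadPricing` of crux 9225's line (quoted verbatim as a hypothesis), crux 9227 `ShellsToBarlowChart` and crux
9226 `LayeredLawsSelectHcp`, through the LANDED P1 (`stub_goodLaw`), P5 (`stub_chargeFromLaw`),
`funnelToShells_of_thresholdBadPricing`, `chargedPatternCrystallizes_proof` and `LennardJonesMinimalDistance_holds`.
-/

noncomputable section

open MeasureTheory

namespace Summit.AtomisticToContinuum.Crystallization.Theorems.PalmGoodLaw

open Summit.AtomisticToContinuum.Crystallization.Theses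
open Summit.AtomisticToContinuum.Crystallization.Theorems.DefectFreeCrystallizes.Negative.PredicateAPI
open Summit.AtomisticToContinuum.Crystallization.Theorems.MinimiserShells.Negative.LoadBearing (eStar GoodShell)
open Literature.MathematicalPhysics.StatisticalMechanics (IsMuGSC lennardJones LennardJonesMinimalDistance_holds)

/-! ## Closure modulo the Palm route's residual obligations (sorry-free, documentation) -/

/-- **The crux modulo {S7″ of crux 9225, crux 9227, crux 9226}** (no sorry, no stub): the threshold pricing of deep
badly-shelled sites on large cube windows of e*-`μ`GSCs (the one open stub `stub_thresholdBadPricing` of crux 9225's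
line, quoted verbatim as a hypothesis), `ShellsToBarlowChart` and `LayeredLawsSelectHcp` imply the crux — through the
LANDED P1, P5 and `funnelToShells_of_thresholdBadPricing`. -/
theorem defectFreeCrystallizes_of_palmResiduals : (∀ δ : ℝ, 0 < δ → ∀ t : ℝ, 0 < t → ∃ L₀ R₀ κ : ℝ, 0 < L₀ ∧ 0 < R₀ ∧ 0 < κ ∧ ∀ S : Set (EuclideanSpace ℝ (Fin 3)), (∀ x ∈ S, ∀ z ∈ S, x ≠ z → δ ≤ dist x z) → IsMuGSC lennardJones eStar S → ∀ L : ℝ, L₀ ≤ L → ∀ a : Fin 3 → ℝ, ∀ C : Finset (EuclideanSpace ℝ (Fin 3)), (↑C : Set (EuclideanSpace ℝ (Fin 3))) = S ∩ {z : EuclideanSpace ℝ (Fin 3) | ∀ i, a i ≤ z i ∧ z i < a i + L} → ∀ G : Finset (EuclideanSpace ℝ (Fin 3)), G ⊆ C → (∀ y ∈ G, ¬ GoodShell ((Measure.count : Measure (EuclideanSpace ℝ (Fin 3))).restrict ((fun z => z - y) '' S)) ∧ S ∩ Metric.closedBall y R₀ ⊆ ↑C) → t * (C.card : ℝ) ≤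 (G.card : ℝ) → (C.card : ℝ) * (eStar + κ) ≤ (∑ x ∈ C, ∑ z ∈ C, lennardJones (dist x z)) / 2) → PalmUnimodularRigidity.ShellsToBarlowChart → PalmUnimodularRigidity.LayeredLawsSelectHcp → Summit.AtomisticToContinuum.Crystallization.Theses.ReggeStarCoercivity.DefectFreeCrystallizes := by
  intro hS7 hChart hSelect
  rw [defectFreeCrystallizes_iff]
  intro hZ
  exact Summit.AtomisticToContinuum.Crystallization.Theorems.chargedPatternCrystallizes_proof
    (stub_chargeFromLaw stub_goodLaw (funnelToShells_of_thresholdBadPricing hS7) hChart hSelect hZ)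
    LennardJonesMinimalDistance_holds


end Summit.AtomisticToContinuum.Crystallization.Theorems.PalmGoodLaw

end
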